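import Mathlib.Algebra.Order.Monoid.TypeTags
import Mathlib.Algebra.Order.Monoid.Canonical.Defs
import Mathlib.Algebra.Order.Floor.Semiring
import Mathlib.Data.NNReal.Basic
import Literature.AlgebraicGeometry.Frobenioids.Monoids
import Literature.AlgebraicGeometry.Frobenioids.MonoidRealification

/-!
# Coordinates on the completion `N ⊗ ℝ_{≥0}` of a monoprime monoid (toolkit for [EtTh] Lemma 3.5)

Source of the objects: S. Mochizuki, *The geometry of Frobenioids I*, §0 p. 10 (`Λ`-monoprime monoids,
the completion `M ⊗ ℝ_{≥0}`) [MochizukiFrdI2008]; they are used here as the first step of the proof of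
S. Mochizuki, *The étale theta function …* [MochizukiEtTh2009], Lemma 3.5, PDF pp. 75–76 (printed
301–302): the "`P^rlf`" portion of that lemma compares a perf-factorial monoid with its realification
prime by prime, i.e. inside the completions `M^pf_𝔭 ⊗ ℝ_{≥0}` of the monoprime monoids `M^pf_𝔭`
([FrdI] Def. 2.4 (i)).

For a monoprime monoid `N` (tree: `IsMonoprime N`, i.e. `N ≅ ℤ_{≥0}`, `ℚ_{≥0}` or `ℝ_{≥0}`) the tree's
completion `Realification N = (N^∨)^∨` is `ℝ`-monoprime (`isRMonoprime_realification`), so it admits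
*coordinates* `f : Realification N ≃* Multiplicative ℝ≥0`. This file proves, for ANY such `f` and the
composite `g := f ∘ (N → N ⊗ ℝ_{≥0})`:

* `chart`: `g` is a homothety in a chart — there are `c > 0` and an additive identification of `N` with
  `Λ_{≥0}` under which `g` is `x ↦ c · x`;
* `dvd_of_coord_le`: `g` reflects the order (`g x ≤ g y ⇒ x ∣ y`; so the image of `N` is
  group-saturated in its completion);
* `exists_approx`: the image of `N` is a "lattice or dense": every `r ∈ ℝ_{≥0}` lies in an interval
  `[g a, g (a·ε)]` for any prescribed non-trivial step `ε ∈ N`;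
* `coord_surjective_of_isRMonoprime`: for `ℝ`-monoprime `N` the map `N → N ⊗ ℝ_{≥0}` is bijective;
* the dictionary `x ∣ y ↔ x ≤ y` in `Multiplicative ℝ≥0`.

Proof-only toolkit (no definitions); multiplicative notation as in `Frobenioids/Monoids.lean`.
Seat abc-iut-L2-d2 (cell abc-iut, node EtTh:Lem3.5 rlf portion).
-/


namespace Literature.AnabelianGeometry.EtaleTheta

namespace RealificationCoord

open Literature.AlgebraicGeometry.Frobenioids NNReal Function

universe u

/-! ### The dictionary in `Multiplicative ℝ≥0` -/

/-- In `Multiplicative ℝ≥0` divisibility (the order `≤` of [FrdI] §0: `a ≤ b` iff `∃ c, a + c = b`) is the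
order of `ℝ≥0`. [cite: MochizukiFrdI2008, §0 p.12] -/
theorem mnnreal_dvd_iff_le (x y : Multiplicative ℝ≥0) : x ∣ y ↔ x ≤ y := by
  rw [le_iff_exists_mul]
  exact ⟨fun ⟨c, hc⟩ => ⟨c, hc⟩, fun ⟨c, hc⟩ => ⟨c, hc⟩⟩

/-- In `Multiplicative ℝ≥0`, `x ≤ y` is `toAdd x ≤ toAdd y` (bookkeeping for the `≤` of [FrdI] §0).
[cite: MochizukiFrdI2008, §0 p.12] -/
theorem mnnreal_le_iff (x y : Multiplicative ℝ≥0) : x ≤ y ↔ x.toAdd ≤ y.toAdd := Iff.rfl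

/-- In a product of copies of `Multiplicative ℝ≥0` divisibility (the `≤` of [FrdI] §0) is the pointwise
order — the order on `M^rlf_factor = ∏_𝔭 M^rlf_𝔭` of [FrdI] Def. 2.4 (i)(c) in coordinates.
[cite: MochizukiFrdI2008, Def. 2.4(i) p.47] -/
theorem pi_mnnreal_dvd_iff_le {I : Type u} (x y : I → Multiplicative ℝ≥0) : x ∣ y ↔ x ≤ y := by
  constructor
  · rintro ⟨c, rfl⟩ i
    exact (mnnreal_dvd_iff_le _ _).mp ⟨c i, rfl⟩
  · intro h
    refine ⟨fun i => Classical.choose ((mnnreal_dvd_iff_le _ _).mpr (h i)), funext fun i => ?_⟩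
    exact Classical.choose_spec ((mnnreal_dvd_iff_le _ _).mpr (h i))

variable {N : Type u} [CommMonoid N]

/-! ### Coordinates exist -/

/-- For a monoprime `N`, the completion `N ⊗ ℝ_{≥0}` admits a coordinate `N ⊗ ℝ_{≥0} ≅ ℝ_{≥0}`
([FrdI] §0 p. 10: "the `ℝ`-monoprime monoid obtained by completing"). [cite: MochizukiFrdI2008, §0 p.10] -/
theorem nonempty_coord (hN : IsMonoprime N) : Nonempty (Realification N ≃* Multiplicative ℝ≥0) :=
  (isRMonoprime_realification hN).nonempty_mulEquiv

/-! ### The chart: `g = f ∘ of` is a homothety -/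

section Chart

variable (f : Realification N ≃* Multiplicative ℝ≥0)

/-- `g` is injective for monoprime `N` (`N → N ⊗ ℝ_{≥0}` is injective, [FrdI] §0 p. 10).
[cite: MochizukiFrdI2008, §0 p.10] -/
theorem coord_injective (hN : IsMonoprime N) :
    Injective (fun x : N => Multiplicative.toAdd (f (Realification.of N x))) :=
  fun _ _ h => Realification.of_injective hN (f.injective (Multiplicative.toAdd.injective h))

/-- `g` is additive (it is a monoid homomorphism `N → N ⊗ ℝ_{≥0} ≅ ℝ_{≥0}`). [cite: MochizukiFrdI2008, §0 p.10] -/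
theorem coord_mul (x y : N) :
    Multiplicative.toAdd (f (Realification.of N (x * y))) =
      Multiplicative.toAdd (f (Realification.of N x)) + Multiplicative.toAdd (f (Realification.of N y)) := by
  rw [map_mul, map_mul, toAdd_mul]

/-- `g 1 = 0`. [cite: MochizukiFrdI2008, §0 p.10] -/
theorem coord_one : Multiplicative.toAdd (f (Realification.of N 1)) = 0 := by
  rw [map_one, map_one, toAdd_one]

/-- `g (x ^ n) = n • g x`. [cite: MochizukiFrdI2008, §0 p.10] -/
theorem coord_pow (x : N) (n : ℕ) :
    Multiplicative.toAdd (f (Realification.of N (x ^ n))) =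
      n * Multiplicative.toAdd (f (Realification.of N x)) := by
  rw [map_pow, map_pow, toAdd_pow, nsmul_eq_mul]

/-- Generic chart computation: transporting `g` along a chart `e : N ≅ Λ_{≥0}` gives an additive map
`φ : Λ_{≥0} → ℝ_{≥0}` with `g x = φ (e x)` and `φ 1 ≠ 0` (by injectivity of `g`), for any `Λ_{≥0}`
with `1 ≠ 0`. [folklore] -/
private theorem exists_chartHom (hN : IsMonoprime N) {A : Type} [AddCommMonoid A] [One A]
    (h10 : (1 : A) ≠ 0) (e : N ≃* Multiplicative A) :
    ∃ φ : A →+ ℝ≥0, φ 1 ≠ 0 ∧ ∀ x : N,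
      Multiplicative.toAdd (f (Realification.of N x)) = φ (Multiplicative.toAdd (e x)) := by
  let φ : A →+ ℝ≥0 := AddMonoidHom.toMultiplicative.symm
    ((f.toMonoidHom.comp (Realification.of N)).comp e.symm.toMonoidHom)
  have hφ : ∀ a : A, φ a = Multiplicative.toAdd (f (Realification.of N (e.symm (Multiplicative.ofAdd a)))) :=
    fun _ => rfl
  refine ⟨φ, fun h => h10 ?_, fun x => ?_⟩
  · have h1 : φ 1 = φ 0 := by rw [h, map_zero]
    rw [hφ, hφ] at h1
    exact Multiplicative.ofAdd.injective (e.symm.injective (coord_injective f hN h1))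
  · rw [hφ, ofAdd_toAdd, MulEquiv.symm_apply_apply]

/-- **Chart, case `Λ = ℤ`.** If `e : N ≅ ℤ_{≥0}` then `g x = c · e(x)` with `c = g(e⁻¹ 1) ≠ 0`.
[cite: MochizukiFrdI2008, §0 p.10] -/
theorem chart_Z (e : N ≃* Multiplicative ℕ) :
    ∃ c : ℝ≥0, c ≠ 0 ∧ ∀ x : N,
      Multiplicative.toAdd (f (Realification.of N x)) = c * ((Multiplicative.toAdd (e x) : ℕ) : ℝ≥0) := by
  obtain ⟨φ, hφ, hg⟩ := exists_chartHom f (IsMonoprime.ofZ ⟨⟨e⟩⟩) one_ne_zero e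
  refine ⟨φ 1, hφ, fun x => ?_⟩
  rw [hg x]
  set n := Multiplicative.toAdd (e x)
  have : φ n = n • φ 1 := by rw [← map_nsmul, smul_eq_mul, mul_one]
  rw [this, nsmul_eq_mul, mul_comm]

/-- **Chart, case `Λ = ℚ`.** If `e : N ≅ ℚ_{≥0}` then `g x = c · e(x)` with `c ≠ 0` (an additive map
`ℚ_{≥0} → ℝ_{≥0}` is a homothety). [cite: MochizukiFrdI2008, §0 p.10] -/
theorem chart_Q (e : N ≃* Multiplicative ℚ≥0) :
    ∃ c : ℝ≥0, c ≠ 0 ∧ ∀ x : N,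
      Multiplicative.toAdd (f (Realification.of N x)) = c * ((Multiplicative.toAdd (e x) : ℚ≥0) : ℝ≥0) := by
  obtain ⟨φ, hφ, hg⟩ := exists_chartHom f (IsMonoprime.ofQ ⟨⟨e⟩⟩) one_ne_zero e
  refine ⟨φ 1, hφ, fun x => ?_⟩
  rw [hg x]
  exact addMonoidHom_nnrat_apply φ _

/-- **Chart, case `Λ = ℝ`.** If `e : N ≅ ℝ_{≥0}` then `g x = c · e(x)` with `c ≠ 0` (an additive map
`ℝ_{≥0} → ℝ_{≥0}` is a homothety). [cite: MochizukiFrdI2008, §0 p.10] -/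
theorem chart_R (e : N ≃* Multiplicative ℝ≥0) :
    ∃ c : ℝ≥0, c ≠ 0 ∧ ∀ x : N,
      Multiplicative.toAdd (f (Realification.of N x)) = c * Multiplicative.toAdd (e x) := by
  obtain ⟨φ, hφ, hg⟩ := exists_chartHom f (IsMonoprime.ofR ⟨⟨e⟩⟩) one_ne_zero e
  refine ⟨φ 1, hφ, fun x => ?_⟩
  rw [hg x]
  exact addMonoidHom_nnreal_apply φ _

/-! ### Order reflection: the image of `N` is group-saturated in its completion -/

/-- **Order reflection.** For monoprime `N` and any coordinate `f`, if `g x ≤ g y` then `x ∣ y` in `N`: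
the completion `N → N ⊗ ℝ_{≥0}` reflects the order `≤` of [FrdI] §0 (equivalently, the image of
`N` is group-saturated in `N ⊗ ℝ_{≥0}`). Used in [EtTh] Lemma 3.5 to compare `P^pf ⊆ P^rlf`.
[cite: MochizukiEtTh2009, Lem 3.5 p.75] -/
theorem dvd_of_coord_le (hN : IsMonoprime N) {x y : N}
    (h : Multiplicative.toAdd (f (Realification.of N x)) ≤ Multiplicative.toAdd (f (Realification.of N y))) :
    x ∣ y := by
  rcases hN with hZ | hQ | hR
  · obtain ⟨⟨e⟩⟩ := hZ
    obtain ⟨c, hc, hg⟩ := chart_Z f e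
    rw [hg, hg] at h
    have h' : Multiplicative.toAdd (e x) ≤ Multiplicative.toAdd (e y) := by
      exact_mod_cast le_of_mul_le_mul_left h (pos_iff_ne_zero.mpr hc)
    obtain ⟨d, hd⟩ := Nat.exists_eq_add_of_le h'
    refine ⟨e.symm (Multiplicative.ofAdd d), e.injective ?_⟩
    rw [map_mul, MulEquiv.apply_symm_apply, ← ofAdd_toAdd (e x), ← ofAdd_add, ← hd, ofAdd_toAdd]
  · obtain ⟨⟨e⟩⟩ := hQ
    obtain ⟨c, hc, hg⟩ := chart_Q f e
    rw [hg, hg] at h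
    have h' : Multiplicative.toAdd (e x) ≤ Multiplicative.toAdd (e y) := by
      exact_mod_cast le_of_mul_le_mul_left h (pos_iff_ne_zero.mpr hc)
    obtain ⟨d, hd⟩ := exists_add_of_le h'
    refine ⟨e.symm (Multiplicative.ofAdd d), e.injective ?_⟩
    rw [map_mul, MulEquiv.apply_symm_apply, ← ofAdd_toAdd (e x), ← ofAdd_add, ← hd, ofAdd_toAdd]
  · obtain ⟨⟨e⟩⟩ := hR
    obtain ⟨c, hc, hg⟩ := chart_R f e
    rw [hg, hg] at h
    have h' : Multiplicative.toAdd (e x) ≤ Multiplicative.toAdd (e y) :=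
      le_of_mul_le_mul_left h (pos_iff_ne_zero.mpr hc)
    obtain ⟨d, hd⟩ := exists_add_of_le h'
    refine ⟨e.symm (Multiplicative.ofAdd d), e.injective ?_⟩
    rw [map_mul, MulEquiv.apply_symm_apply, ← ofAdd_toAdd (e x), ← ofAdd_add, ← hd, ofAdd_toAdd]

/-- The converse (trivial) direction: `x ∣ y` implies `g x ≤ g y` (`N → N ⊗ ℝ_{≥0}` is order-preserving,
[FrdI] §0 p. 10). [cite: MochizukiFrdI2008, §0 p.10] -/
theorem coord_le_of_dvd {x y : N} (h : x ∣ y) :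
    Multiplicative.toAdd (f (Realification.of N x)) ≤ Multiplicative.toAdd (f (Realification.of N y)) :=
  (mnnreal_le_iff _ _).mp ((mnnreal_dvd_iff_le _ _).mp (map_dvd f (map_dvd (Realification.of N) h)))

/-! ### Approximation: the image of `N` is a lattice `c · ℤ_{≥0}` or dense -/

/-- A real `r ≥ 0` is within one step `q > 0` above a multiple `⌊r/q⌋ · q`. [folklore] -/
private theorem floor_step (r q : ℝ≥0) (hq : q ≠ 0) :
    (⌊r / q⌋₊ : ℝ≥0) * q ≤ r ∧ r ≤ ((⌊r / q⌋₊ : ℝ≥0) + 1) * q := by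
  have hq' : 0 < q := pos_iff_ne_zero.mpr hq
  constructor
  · calc (⌊r / q⌋₊ : ℝ≥0) * q ≤ (r / q) * q := by gcongr; exact Nat.floor_le zero_le
      _ = r := div_mul_cancel₀ r hq
  · calc r = (r / q) * q := (div_mul_cancel₀ r hq).symm
      _ ≤ ((⌊r / q⌋₊ : ℝ≥0) + 1) * q := by gcongr; exact (Nat.lt_floor_add_one _).le

/-- **Approximation.** For monoprime `N`, any coordinate `f`, any `r ∈ ℝ_{≥0}` and any non-trivial step
`ε ∈ N`, there is `a ∈ N` with `g a ≤ r ≤ g (a · ε)`: the image of `N` in its completion is either a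
lattice `c · ℤ_{≥0}` (then use `⌊·⌋`) or contains `c · ℚ_{≥0}` (dense). This is the "for every
`a ∈ P^rlf` there exists `a' ∈ P^pf` such that `a' ≥ a`" step of [EtTh] Lemma 3.5, sharpened to
two-sided approximation with prescribed gap. [cite: MochizukiEtTh2009, Lem 3.5 p.75] -/
theorem exists_approx (hN : IsMonoprime N) (r : ℝ≥0) {ε : N} (hε : ε ≠ 1) :
    ∃ a : N, Multiplicative.toAdd (f (Realification.of N a)) ≤ r ∧
      r ≤ Multiplicative.toAdd (f (Realification.of N (a * ε))) := by
  -- the step in coordinates is non-zero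
  have hgε : Multiplicative.toAdd (f (Realification.of N ε)) ≠ 0 := by
    intro h
    exact hε (coord_injective f hN (h.trans (coord_one f).symm))
  rcases hN with hZ | hQ | hR
  · obtain ⟨⟨e⟩⟩ := hZ
    obtain ⟨c, hc, hg⟩ := chart_Z f e
    -- lattice case: steps are multiples of `c`; round `r` down to a multiple of `g ε`
    set q := Multiplicative.toAdd (f (Realification.of N ε)) with hq_def
    obtain ⟨h1, h2⟩ := floor_step r q hgε
    set k : ℕ := ⌊r / q⌋₊
    refine ⟨ε ^ k, ?_, ?_⟩
    · rw [coord_pow]; exact h1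
    · rw [coord_mul, coord_pow, ← hq_def]
      calc r ≤ ((k : ℝ≥0) + 1) * q := h2
        _ = k * q + q := by ring
  · obtain ⟨⟨e⟩⟩ := hQ
    obtain ⟨c, hc, hg⟩ := chart_Q f e
    set q := Multiplicative.toAdd (f (Realification.of N ε)) with hq_def
    obtain ⟨h1, h2⟩ := floor_step r q hgε
    set k : ℕ := ⌊r / q⌋₊
    refine ⟨ε ^ k, ?_, ?_⟩
    · rw [coord_pow]; exact h1
    · rw [coord_mul, coord_pow, ← hq_def]
      calc r ≤ ((k : ℝ≥0) + 1) * q := h2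
        _ = k * q + q := by ring
  · obtain ⟨⟨e⟩⟩ := hR
    obtain ⟨c, hc, hg⟩ := chart_R f e
    -- dense case: hit `r` exactly
    refine ⟨e.symm (Multiplicative.ofAdd (r / c)), ?_, ?_⟩
    · rw [hg, MulEquiv.apply_symm_apply, toAdd_ofAdd, mul_div_cancel₀ r hc]
    · rw [coord_mul, hg (e.symm _), MulEquiv.apply_symm_apply, toAdd_ofAdd, mul_div_cancel₀ r hc]
      exact le_self_add

/-- A monoid with a chart `N ≅ Λ_{≥0}` onto a non-trivial `Λ_{≥0}` has a non-trivial element. [folklore] -/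
private theorem exists_ne_one_of_chart {A : Type} [AddMonoid A] (e : N ≃* Multiplicative A) (a : A)
    (ha : a ≠ 0) : ∃ ε : N, ε ≠ 1 := by
  refine ⟨e.symm (Multiplicative.ofAdd a), fun h => ha ?_⟩
  have := congrArg e h
  rw [MulEquiv.apply_symm_apply, MulEquiv.map_one, ← ofAdd_zero] at this
  exact Multiplicative.ofAdd.injective this

/-- **Cofinality.** For monoprime `N` and any coordinate, every `r ∈ ℝ_{≥0}` is bounded by some `g b`
("there exists `a' ∈ P^pf` such that `a' ≥ a`", [EtTh] p. 75). [cite: MochizukiEtTh2009, Lem 3.5 p.75] -/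
theorem exists_coord_ge (hN : IsMonoprime N) (r : ℝ≥0) :
    ∃ b : N, r ≤ Multiplicative.toAdd (f (Realification.of N b)) := by
  -- a monoprime monoid has a non-trivial element
  have hex : ∃ ε : N, ε ≠ 1 := by
    rcases hN with ⟨⟨⟨e⟩⟩⟩ | ⟨⟨⟨e⟩⟩⟩ | ⟨⟨⟨e⟩⟩⟩
    · exact exists_ne_one_of_chart e 1 one_ne_zero
    · exact exists_ne_one_of_chart e 1 one_ne_zero
    · exact exists_ne_one_of_chart e 1 one_ne_zero
  obtain ⟨ε, hε⟩ := hex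
  obtain ⟨a, -, h⟩ := exists_approx f hN r hε
  exact ⟨a * ε, h⟩

/-! ### `ℝ`-monoprime monoids are complete -/

/-- **Completeness of `ℝ`-monoprime monoids.** If `N` is `ℝ`-monoprime then `g = f ∘ of` is
surjective, i.e. `N → N ⊗ ℝ_{≥0}` is bijective: completing `ℝ_{≥0}` changes nothing ([FrdI] §0 p. 10;
this is why "`ℝ` supports `Q`" makes `Q` complete in [EtTh] Lemma 3.5).
[cite: MochizukiFrdI2008, §0 p.10] -/
theorem coord_surjective_of_isRMonoprime (hN : IsRMonoprime N) :
    Surjective (fun x : N => Multiplicative.toAdd (f (Realification.of N x))) := by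
  obtain ⟨⟨e⟩⟩ := hN
  obtain ⟨c, hc, hg⟩ := chart_R f e
  intro r
  refine ⟨e.symm (Multiplicative.ofAdd (r / c)), ?_⟩
  dsimp only
  rw [hg, MulEquiv.apply_symm_apply, toAdd_ofAdd, mul_div_cancel₀ r hc]

/-- For `ℝ`-monoprime `N`, the natural map `N → N ⊗ ℝ_{≥0}` is surjective.
[cite: MochizukiFrdI2008, §0 p.10] -/
theorem of_surjective_of_isRMonoprime (hN : IsRMonoprime N) : Surjective (Realification.of N) := by
  obtain ⟨f⟩ := nonempty_coord (IsMonoprime.ofR hN)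
  intro z
  obtain ⟨x, hx⟩ := coord_surjective_of_isRMonoprime f hN (Multiplicative.toAdd (f z))
  exact ⟨x, f.injective (Multiplicative.toAdd.injective hx)⟩

/-- For `ℝ`-monoprime `N`, the natural map `N → N ⊗ ℝ_{≥0}` is bijective.
[cite: MochizukiFrdI2008, §0 p.10] -/
theorem of_bijective_of_isRMonoprime (hN : IsRMonoprime N) : Bijective (Realification.of N) :=
  ⟨Realification.of_injective (IsMonoprime.ofR hN), of_surjective_of_isRMonoprime hN⟩

end Chart

end RealificationCoord

end Literature.AnabelianGeometry.EtaleTheta
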